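import Literature.AlgebraicGeometry.CossartPiltant200819.Threefolds2008
import Literature.AlgebraicGeometry.Resolution.AffineDomainDimension
import Literature.AlgebraicGeometry.Resolution.ResolutionLU
import Literature.AlgebraicGeometry.Resolution.CossartPiltant2019CharZero
import HarnessLib

/-!
# Cossart–Piltant 2008/2009 inside the tree: the 2019 theorem and Hironaka's theorem as sources

Proofs only (no new notions, no new named facts). The local uniformization statements of
Cossart–Piltant 2008 typed in `Ramification2008.lean` / `Threefolds2008.lean` (`LU3RankOne k`,
`LU3DiffFinite`, the hypothesis of `RefinedPatching`, `ArtinSchreierHypothesis k`) are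
CONSEQUENCES of the tree's relative local uniformization in dimension three
`Resolution.LocalUniformization3 k` (Cossart–Piltant 2019 §4.1 (LU)), hence of the named fact
`Resolution.CossartPiltant2019` (Thm 1.1 of the 2019 paper, any field) via the PROVED
`Resolution.CossartPiltant2019.lu3` (`ResolutionLU.lean`), and in characteristic zero they are
THEOREMS via `Resolution.Hironaka1964_holds`. Ingredients: `Resolution.exists_affineModel` (an
affine model inside the valuation ring), `Resolution.ringKrullDim_le_of_fg_of_trdeg_le`
(dimension of affine models = transcendence degree), Mathlib's `trdeg_add_eq`,
`IntermediateField.fg_top_iff`, `IsAdjoinRootMonic.finite`.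

* `isLocallyUniformizable_of_localUniformization3` — `LocalUniformization3 k` uniformizes every
  `k`-valuation ring of every finitely generated `K/k` with `trdeg_k K ≤ 3`;
* `lu3RankOne_of_localUniformization3`, `lu3DiffFinite_of_cossartPiltant2019LU3`,
  `lu3DiffFinite_of_cossartPiltant2019`, `resolutionOfAffineModels_of_cossartPiltant2019`;
* `artinSchreierHypothesis_of_localUniformization3` — the hypothesis `H(k)` of CP 2008 Thm 7.2
  (= what CP 2009 proves) follows from `LocalUniformization3 k` (the covering field `L = K[X]/(h)`
  is again finitely generated of transcendence degree three);
* `lu3RankOne_of_charZero`, `artinSchreierHypothesis_of_charZero` — unconditional in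
  characteristic zero (Zariski 1940 via `Hironaka1964_holds`);
* `lu3RankOne_of_localUniformizationInChar` — `LU3RankOne` is the transcendence-degree-three,
  rank-one slice of the tree's `Resolution.LocalUniformizationInChar p`;
* `reductionToArtinSchreier_of_cossartPiltant2019LU3`, `climbToInertiaField_of_…`,
  `primeDegreeAscent_of_…`, `tamePrimeDescent_of_…`, `descentBelowRamificationField_of_…`,
  `rankReduction_of_…`,
  `cp2008_bareLU_of_cossartPiltant2019` — every CP 2008 statement whose conclusion is a bare
  local uniformization follows from CP 2019 (LU)₃ / Thm 1.1 (`fg_and_trdeg_of_finite`: finite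
  extensions stay finitely generated of transcendence degree three).
-/

noncomputable section

open Polynomial

namespace Literature.AlgebraicGeometry.CossartPiltant200819.CP2008

open Literature.AlgebraicGeometry.Resolution

universe u

/-- **Relative LU in dimension three uniformizes function fields of transcendence degree `≤ 3`**:
pick an affine model `A ⊆ O` (`exists_affineModel`), whose Krull dimension is `trdeg_k K ≤ 3`
(`ringKrullDim_le_of_fg_of_trdeg_le`), and apply `LocalUniformization3`. [folklore] -/
theorem isLocallyUniformizable_of_localUniformization3 {k : Type u} [Field k]
    (h : LocalUniformization3 k) (K : Type u) [Field K] [Algebra k K]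
    (hfg : (⊤ : IntermediateField k K).FG) (h3 : Algebra.trdeg k K ≤ 3) (O : ValuationSubring K)
    (hk : ∀ c : k, algebraMap k K c ∈ O) : IsLocallyUniformizable k K O := by
  obtain ⟨A, hAO, hAfg, hAfr⟩ := exists_affineModel k K hfg O hk
  haveI := hAfr
  exact h.isLocallyUniformizable K O A hAO hAfg hAfr
    (ringKrullDim_le_of_fg_of_trdeg_le A hAfg (by exact_mod_cast h3))

/-- `LocalUniformization3 k` gives the conclusion of CP 2008 Thm 7.2 for `k` (rank one and
residual algebraicity are not even needed). [folklore] -/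
theorem lu3RankOne_of_localUniformization3 {k : Type u} [Field k] (h : LocalUniformization3 k) :
    LU3RankOne k :=
  fun K _ _ hfg h3 O hk _ _ => isLocallyUniformizable_of_localUniformization3 h K hfg h3.le O hk

/-- `CossartPiltant2019LU3` (relative LU in dimension three over every field) gives the local
uniformization theorem of CP 2008/2009 (differential finiteness is not needed). [folklore] -/
theorem lu3DiffFinite_of_cossartPiltant2019LU3 (h : CossartPiltant2019LU3.{u}) :
    LU3DiffFinite.{u} :=
  fun _ _ k _ _ _ K _ _ hfg h3 O hk => isLocallyUniformizable_of_localUniformization3 (h k) K hfg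
    h3.le O hk

/-- **CP 2019 Thm 1.1 ⟹ the LU theorem of CP 2008/2009**, through the tree's proved
`CossartPiltant2019.lu3`. [folklore] -/
theorem lu3DiffFinite_of_cossartPiltant2019 (h : CossartPiltant2019.{u}) : LU3DiffFinite.{u} :=
  lu3DiffFinite_of_cossartPiltant2019LU3 h.lu3

/-- CP 2019 Thm 1.1 and CP 2008 Prop 4.9 give Thm 2.1 (i)(ii) on affine models (the patching
proposition supplies the isomorphism over the regular locus, which `Scheme.HasResolution` does
not record). [folklore] -/
theorem resolutionOfAffineModels_of_cossartPiltant2019 (h : CossartPiltant2019.{u})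
    (p49 : RefinedPatching.{u}) : ResolutionOfAffineModels.{u} :=
  resolutionOfAffineModels_of_lu3 (lu3DiffFinite_of_cossartPiltant2019 h) p49

/-- The Artin–Schreier / purely inseparable polynomial `X^p − g^{p−1}X + f` is monic (`p` prime).
[folklore] -/
theorem monic_artinSchreierPoly {K : Type u} [Field K] {p : ℕ} (hp : p.Prime) (f g : K) :
    (X ^ p - C (g ^ (p - 1)) * X + C f : K[X]).Monic := by
  have hp1 : (1 : WithBot ℕ) < (p : WithBot ℕ) := by exact_mod_cast hp.one_lt
  have hlt : (C (g ^ (p - 1)) * X : K[X]).degree < (X ^ p : K[X]).degree := by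
    rw [degree_X_pow]; exact (degree_C_mul_X_le _).trans_lt hp1
  have hm1 : (X ^ p - C (g ^ (p - 1)) * X : K[X]).Monic := (monic_X_pow p).sub_of_left hlt
  refine hm1.add_of_left ?_
  rw [degree_sub_eq_left_of_degree_lt hlt, degree_X_pow]
  exact degree_C_le.trans_lt (by exact_mod_cast hp.pos)

/-- A finite extension `L/K` of a finitely generated `K/k` of transcendence degree three is again
finitely generated of transcendence degree three over `k` (`Algebra.EssFiniteType.comp`,
`IntermediateField.fg_top_iff`, `trdeg_add_eq`, `trdeg_eq_zero`). [folklore] -/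
theorem fg_and_trdeg_of_finite {k K L : Type u} [Field k] [Field K] [Algebra k K] [Field L]
    [Algebra K L] [Algebra k L] [IsScalarTower k K L] (hfg : (⊤ : IntermediateField k K).FG)
    (h3 : Algebra.trdeg k K = 3) [Module.Finite K L] :
    (⊤ : IntermediateField k L).FG ∧ Algebra.trdeg k L = 3 := by
  haveI : Algebra.EssFiniteType k K := IntermediateField.fg_top_iff.mp hfg
  haveI : Algebra.EssFiniteType K L := inferInstance
  haveI : Algebra.EssFiniteType k L := Algebra.EssFiniteType.comp k K L
  refine ⟨IntermediateField.fg_top_iff.mpr inferInstance, ?_⟩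
  haveI : FaithfulSMul k K := (faithfulSMul_iff_algebraMap_injective k K).mpr
    (algebraMap k K).injective
  haveI : FaithfulSMul K L := (faithfulSMul_iff_algebraMap_injective K L).mpr
    (algebraMap K L).injective
  have := trdeg_add_eq k K (A := L)
  rw [h3, trdeg_eq_zero (R := K) (A := L), add_zero] at this
  exact this.symm

/-- A simple extension `L = K[X]/(h)` by the Artin–Schreier / purely inseparable polynomial of a
finitely generated `K/k` of transcendence degree three is again finitely generated of
transcendence degree three over `k` (`IsAdjoinRootMonic.finite`). [folklore] -/
theorem fg_and_trdeg_of_isAdjoinRoot {k K L : Type u} [Field k] [Field K] [Algebra k K] [Field L]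
    [Algebra K L] [Algebra k L] [IsScalarTower k K L] (hfg : (⊤ : IntermediateField k K).FG)
    (h3 : Algebra.trdeg k K = 3) {p : ℕ} (hp : p.Prime) (f g : K)
    (hL : Nonempty (IsAdjoinRoot L (X ^ p - C (g ^ (p - 1)) * X + C f : K[X]))) :
    (⊤ : IntermediateField k L).FG ∧ Algebra.trdeg k L = 3 := by
  obtain ⟨i⟩ := hL
  have hmon : IsAdjoinRootMonic L (X ^ p - C (g ^ (p - 1)) * X + C f : K[X]) :=
    ⟨i, monic_artinSchreierPoly hp f g⟩
  haveI : Module.Finite K L := hmon.finite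
  exact fg_and_trdeg_of_finite hfg h3

/-- `k ⊆ W ∩ K` from `k ⊆ W`. [folklore] -/
theorem algebraMap_mem_comap {k K L : Type u} [Field k] [Field K] [Algebra k K] [Field L]
    [Algebra K L] [Algebra k L] [IsScalarTower k K L] {W : ValuationSubring L}
    (hk : ∀ c : k, algebraMap k L c ∈ W) (c : k) :
    algebraMap k K c ∈ W.comap (algebraMap K L) := by
  rw [ValuationSubring.mem_comap, ← IsScalarTower.algebraMap_apply k K L]
  exact hk c

/-- **`LocalUniformization3 k` ⟹ the hypothesis `H(k)` of CP 2008 Thm 7.2** (the statement CP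
2009 proves for differentially finite `k`): the covering field `L` is finitely generated of
transcendence degree three and `W ⊇ k`, so relative LU in dimension three applies to `W`
directly — none of the finer hypotheses (rank one, immediacy, uniqueness) is used. [folklore] -/
theorem artinSchreierHypothesis_of_localUniformization3 {k : Type u} [Field k]
    (h : LocalUniformization3 k) : ArtinSchreierHypothesis k := by
  intro p hp _ K _ _ hfg h3 O hk _ _ R _ f g _ _ _ _ _ _ L _ _ _ _ hL W hWO _ _
  obtain ⟨hfgL, h3L⟩ := fg_and_trdeg_of_isAdjoinRoot hfg h3 hp f g hL
  refine isLocallyUniformizable_of_localUniformization3 h L hfgL h3L.le W fun c => ?_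
  have hc : algebraMap k K c ∈ W.comap (algebraMap K L) := by rw [hWO]; exact hk c
  rw [ValuationSubring.mem_comap] at hc
  rwa [IsScalarTower.algebraMap_apply k K L]

/-- `CossartPiltant2019LU3` gives `CossartPiltant2009Main` (and more: `H(k)` for every `k`).
[folklore] -/
theorem cossartPiltant2009Main_of_cossartPiltant2019LU3 (h : CossartPiltant2019LU3.{u}) :
    CossartPiltant2009Main.{u} :=
  fun _ _ k _ _ _ => artinSchreierHypothesis_of_localUniformization3 (h k)

/-- **Characteristic zero, unconditionally** (Zariski 1940 through `Hironaka1964_holds`): the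
conclusion of CP 2008 Thm 7.2 holds for every field of characteristic zero. [folklore] -/
theorem lu3RankOne_of_charZero (k : Type u) [Field k] [CharZero k] : LU3RankOne k := by
  haveI := CharP.ofCharZero k
  exact fun K _ _ hfg _ O hk _ _ => Hironaka1964_holds.localUniformizationInChar k K hfg O hk

/-- `LU3RankOne` is the transcendence-degree-three, rank-one slice of the tree's
`LocalUniformizationInChar p` (any `p`, including `0`). [folklore] -/
theorem lu3RankOne_of_localUniformizationInChar {p : ℕ} (h : LocalUniformizationInChar.{u} p)
    (k : Type u) [Field k] [CharP k p] : LU3RankOne k :=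
  fun K _ _ hfg _ O hk _ _ => h k K hfg O hk

/-- `LocalUniformizationInChar p` gives the LU theorem of CP 2008/2009 in characteristic `p`.
[folklore] -/
theorem lu3DiffFinite_of_localUniformizationInChar
    (h : ∀ p : ℕ, p.Prime → LocalUniformizationInChar.{u} p) : LU3DiffFinite.{u} :=
  fun p hp k _ _ _ K _ _ hfg _ O hk => h p hp.out k K hfg O hk

/-- In characteristic zero the hypothesis `H(k)` of Thm 7.2 is vacuous-in-spirit but in any case a
theorem: its conclusion holds by `Hironaka1964_holds` (the covering field is finitely generated).
[folklore] -/
theorem artinSchreierHypothesis_of_charZero (k : Type u) [Field k] [CharZero k] :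
    ArtinSchreierHypothesis k := by
  intro p hp _ K _ _ hfg h3 O hk _ _ R _ f g _ _ _ _ _ _ L _ _ _ _ hL W hWO _ _
  obtain ⟨hfgL, -⟩ := fg_and_trdeg_of_isAdjoinRoot hfg h3 hp f g hL
  haveI := CharP.ofCharZero k
  refine Hironaka1964_holds.localUniformizationInChar k L hfgL W fun c => ?_
  have hc : algebraMap k K c ∈ W.comap (algebraMap K L) := by rw [hWO]; exact hk c
  rw [ValuationSubring.mem_comap] at hc
  rwa [IsScalarTower.algebraMap_apply k K L]

/-! ### The statements of CP 2008 §§5–9 whose conclusion is a bare local uniformization follow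
from `CossartPiltant2019LU3` (every field met is finitely generated of transcendence degree three
over `k`). Not so derivable (finer conclusions): `Cofinality`, `GaloisApproximation`,
`MonomialUniformization`, `DescentBelowInertiaField`, `RefinedPatching`,
`ResolutionAffineThreefolds`. -/

/-- CP 2019 (LU)₃ ⟹ CP 2008 Thm 7.2 (its conclusion holds outright). [folklore] -/
theorem reductionToArtinSchreier_of_cossartPiltant2019LU3 (h : CossartPiltant2019LU3.{u}) :
    ReductionToArtinSchreier.{u} :=
  fun k _ _ _ _ _ => lu3RankOne_of_localUniformization3 (h k)

/-- CP 2019 (LU)₃ ⟹ CP 2008 Cor 6.3 (`K'` is finite over `K`, hence finitely generated of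
transcendence degree three over `k`). [folklore] -/
theorem climbToInertiaField_of_cossartPiltant2019LU3 (h : CossartPiltant2019LU3.{u}) :
    ClimbToInertiaField.{u} := by
  intro k K _ _ _ hfg h3 L _ _ _ _ hfin _ W hk K' _ _
  haveI := hfin
  haveI : Module.Finite K K' := inferInstance
  obtain ⟨hfg', h3'⟩ := fg_and_trdeg_of_finite (L := K') hfg h3
  refine isLocallyUniformizable_of_localUniformization3 (h k) K' hfg' h3'.le _ fun c => ?_
  rw [ValuationSubring.mem_comap, IsScalarTower.algebraMap_apply k K K',
    ← IsScalarTower.algebraMap_apply K K' L, ← IsScalarTower.algebraMap_apply k K L]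
  exact hk c

/-- CP 2019 (LU)₃ ⟹ CP 2008 Prop 8.3 (`[L:K]` prime, so `L` is finite over `K`). [folklore] -/
theorem primeDegreeAscent_of_cossartPiltant2019LU3 (h : CossartPiltant2019LU3.{u}) :
    PrimeDegreeAscent.{u} := by
  intro k K _ _ _ hfg h3 L _ _ _ _ hprime W hk _ _ _
  haveI : Module.Finite K L := Module.finite_of_finrank_pos hprime.pos
  obtain ⟨hfgL, h3L⟩ := fg_and_trdeg_of_finite (L := L) hfg h3
  exact isLocallyUniformizable_of_localUniformization3 (h k) L hfgL h3L.le W hk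

/-- CP 2019 (LU)₃ ⟹ CP 2008 Lemma 9.4 (the conclusion concerns `V = W ∩ K` on `K` itself).
[folklore] -/
theorem tamePrimeDescent_of_cossartPiltant2019LU3 (h : CossartPiltant2019LU3.{u}) :
    TamePrimeDescent.{u} :=
  fun k K _ _ _ hfg h3 _L _ _ _ _ _ _ _ _ _W hk _ _ _ =>
    isLocallyUniformizable_of_localUniformization3 (h k) K hfg h3.le _ (algebraMap_mem_comap hk)

/-- CP 2019 (LU)₃ ⟹ CP 2008 Prop 9.5. [folklore] -/
theorem descentBelowRamificationField_of_cossartPiltant2019LU3 (h : CossartPiltant2019LU3.{u}) :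
    DescentBelowRamificationField.{u} :=
  fun k K _ _ _ hfg h3 _L _ _ _ _ _ _ _W hk _ _ _K' _ _ =>
    isLocallyUniformizable_of_localUniformization3 (h k) K hfg h3.le _ (algebraMap_mem_comap hk)

/-- CP 2019 (LU)₃ ⟹ CP 2008 Prop 5.1 (its conclusion is a bare local uniformization; the rank /
residue-field hypothesis is not used). [folklore] -/
theorem rankReduction_of_cossartPiltant2019LU3 (h : CossartPiltant2019LU3.{u}) :
    RankReduction.{u} :=
  fun k K _ _ _ hfg h3 O hk _ => isLocallyUniformizable_of_localUniformization3 (h k) K hfg h3.le O hk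

/-- **CP 2019 Thm 1.1 ⟹ the bare-LU statements of CP 2008** (Thm 7.2, Cor 6.3, Prop 8.3,
Lemma 9.4, Prop 9.5, the LU theorem and [CP2]'s Main theorem), collected. [folklore] -/
theorem cp2008_bareLU_of_cossartPiltant2019 (h : CossartPiltant2019.{u}) :
    ReductionToArtinSchreier.{u} ∧ ClimbToInertiaField.{u} ∧ PrimeDegreeAscent.{u} ∧
      TamePrimeDescent.{u} ∧ DescentBelowRamificationField.{u} ∧ LU3DiffFinite.{u} ∧
      CossartPiltant2009Main.{u} :=
  ⟨reductionToArtinSchreier_of_cossartPiltant2019LU3 h.lu3,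
    climbToInertiaField_of_cossartPiltant2019LU3 h.lu3,
    primeDegreeAscent_of_cossartPiltant2019LU3 h.lu3, tamePrimeDescent_of_cossartPiltant2019LU3 h.lu3,
    descentBelowRamificationField_of_cossartPiltant2019LU3 h.lu3,
    lu3DiffFinite_of_cossartPiltant2019LU3 h.lu3,
    cossartPiltant2009Main_of_cossartPiltant2019LU3 h.lu3⟩

end Literature.AlgebraicGeometry.CossartPiltant200819.CP2008

end
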